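import Summits.BirchSwinnertonDyer.Rank1Residual.ManinAdditive.ThetaFourOmega
import Summits.BirchSwinnertonDyer.Rank1Residual.ManinAdditive.ThetaFourBrandtDegreeLawAtNineCert
import HarnessLib
import HarnessLib.Audit.Tags

/-!
# Theta visibility of the Néron depth at 3 on the `Iₙ*` stratum (`θ₄²`-module)
(cell bsd-f2-manin, desc lens g22, MEMO-desc §47.13; SIBLING 2 of the landed `ThetaFourOmega.lean` (p739781 + p740055), same
namespace; nothing under `@[conjecture]` is asserted; the assembly is PROVED bookkeeping).

THE `Iₙ*` CASE.  For an `X₀(9p)`-optimal curve of Kodaira type `Iₙ*` at 3 (`n = −v₃(j) ≥ 1`; local type = `χ₋₃`-twisted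
Steinberg) the Brandt vector lives in the `θ₄² = η₃∘Nrd`-module (`IsUnitInvariant3`, `IsThetaFourSqHeckeEigen`, tree
`ThetaFourBrandtDegreeLawAtNineCert.lean` §5) and desc's degree law is E-desc-124 `3 m² deg φ = 4 n · 6⟨g,g⟩`, `m ∈ {1,…,5}`.
The CUSPIDAL theta series of this module are `Θ^{(2)}_{u,x}` with `Σ_z u(z) = 0` (orthogonal to the Eisenstein vector), so
the `f_E`-coordinate of `Θ^{(2)}_{δ_z − δ_{z'}, x}` is `2 (Wg)(x) · \overline{((Wg)(z) − (Wg)(z'))} / ⟨Wg, g⟩`: the theta depth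
is `v₃(6⟨g,g⟩) − 1 − v₃ cont(Wg) − v₃ cont{(Wg)(z) − (Wg)(z')}` (census HOME/desc/g22/nb/E157sq-check.txt: this formula is
EXACT on 25/25 `Iₙ*` classes `9p ≤ 441` — incl. 153b1, the one class with `Wg ≡ const (mod 3)`, where it correctly predicts
depth `v₃⟨g,g⟩ − 1 = 0` — and on 16/16 III/III* classes incl. the out-of-sample 549a1/549b1).  Row E-desc-157₂ below is the resulting
WITNESS statement; the PROVED assembly E-desc-159d: E-157₂ ∧ E-124 (literal) ∧ imc's GIVEN row ∧ `3 ∤ n` ⟹ `3 ∤ c_E` and Néron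
congruence depth at 3 (the `3`-part of `m` only lowers `v₃ deg φ`, so no hypothesis on `m` is needed; for `3 ∣ n` the Néron
depth exceeds the theta depth by one — 99b1, 387d1, 423b1 in the census — and theta series of `B_{3,∞}` alone do not decide).
PARTITION 0 · beyond-print theorem: no · `3 ∤ c_E` is NOT proved by this; BSD is not proved by this; C3 OPEN.

TYPER NOTE (typer g21, T-desc-42).  SOURCE = HOME/desc/g22/Sketch-desc-g22c.lean sha16 74dfec9f13b1da2a (126 l.; desc: farm rc 0 · 0 · 0 · 0;
BC7 1/1 CLEAN vs `ManinLocalTwoThree.ManinPrimeToThreeAtNine`; MEMO-desc §47.13, HOME/desc/g22/memo47.md; census HOME/desc/g22/nb/E157sq-check.txt;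
pack HOME/desc/g22/SHA16SUMS.desc.g22) VERBATIM — desc's header above, every body and docstring below; the only typer delta is this note.
SIBLING 2 of the landed `ThetaFourOmega.lean` (p739781 + p740055) and `ThetaFourOmegaCusps.lean` (T-desc-41), same namespace
`…ManinAdditive.ThetaFourOmega`.  Imports: landed `…ManinAdditive.ThetaFourOmega` + `…ManinAdditive.ThetaFourBrandtDegreeLawAtNineCert` (both
Theses-free; closures 12 + 9 Summits modules) + HarnessLib(+Audit.Tags) — route-independent.  CONTENT: def `WeightedDifferenceNotThreeDivisible`
(`Wg` not Eisenstein mod 3); ROW **E-desc-157₂ `ThetaFourSqOmegaWitnessAtNinePrime`** (desc's `@[conjecture]` tag; THEOREM-candidate = E-desc-156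
at e = 2 + the Brandt spectral formula in the `θ₄²`-module: on the `Iₙ*` stratum at 9p some element of `Ω₃(9p)` has `f_E`-coordinate `q` with
`ord₃ q ≤ 1 − v₃(6⟨g,g⟩)`); PROVED `height_val_of_sqDegreeLaw` (3-adic content of E-desc-124's shape `3m²·deg φ = 4n·(6⟨g,g⟩)`, 3 ∤ n) and
**E-desc-159d `manin_at_three_of_thetaSqWitness_of_degreeLaw`** (E-157₂ ∧ tree row `ThetaFourSqBrandtDegreeLawAtNinePrime` (E-desc-124, literal)
∧ `IsOmegaNeronAtThree Δ` ∧ Kodaira `Iₙ*` with 3 ∤ n ⟹ `¬ 3 ∣ D.maninConstant ∧ Δ.NeronCongruenceDepthAt 3` on optimal curves at 9p).  BC5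
(desc census E157sq-check.txt): theta-depth formula exact on 25/25 `Iₙ*` classes 9p ≤ 441 (incl. 153b1) and 16/16 III/III* (incl. out-of-sample
549a1/549b1); hypotheses of E-157₂ met on 24/25 (not 153b1), theta depth = v₃⟨g,g⟩ 24/24, spectral formula 4606/4606; on the 21 with 3 ∤ n theta
depth = Néron line depth 21/21; on 99b1/387d1/423b1 (3 ∣ n) one less — theta series of B_{3,∞} alone do not decide there (desc).  REFUTER:
ref1/ref2 R-desc-38 PENDING at landing for E-157₂.  Typer checks: 4 decl names fresh tree-wide; cite keys CremonaEcdata / Gross1987Heights in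
references.bib; no instances, no notation, no sorry.  PARTITION 0 · beyond-print theorem: no · bears_on: stmt-BirchSwinnertonDyer-22968 (C3
`ManinPrimeToThreeAtNine`).  `3 ∤ c_E` is NOT proved by this; BSD is not proved by this; C3 OPEN.
-/

namespace Summit.BirchSwinnertonDyer.Rank1Residual.ManinAdditive.ThetaFourOmega

open scoped MatrixGroups ModularForm
open CongruenceSubgroup WeierstrassCurve Literature.NumberTheory.EllipticCurves
open Literature.NumberTheory.EllipticCurves.ModularForms
open Summit.BirchSwinnertonDyer.Rank1Residual.ManinAdditive.HurwitzBrandt (DQuat)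
open Summit.BirchSwinnertonDyer.Rank1Residual.ManinAdditive.ThetaFourBrandt
open Summit.BirchSwinnertonDyer.Rank1Residual.ManinAdditive.NeronOmegaThree

/-- Some difference `(Wg)(z) − (Wg)(z')` of the weighted eigenfunction is a `3`-adic unit of `ℤ[i]` (i.e. `Wg` is NOT
congruent to a constant — an Eisenstein vector — modulo `3`; in the desc census `9p ≤ 441` it fails only for 153b1, which
carries a rational 3-isogeny). [folklore] -/
def WeightedDifferenceNotThreeDivisible (p : ℕ) (g : Fin (p + 1) → ZI) : Prop :=
  ∃ z z' : Fin (p + 1), ¬ ((3 : ℤ) ∣ ((weightMul3 p g z).1 - (weightMul3 p g z').1) ∧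
    (3 : ℤ) ∣ ((weightMul3 p g z).2 - (weightMul3 p g z').2))

/-- **Row E-desc-157₂ `ThetaFourSqOmegaWitnessAtNinePrime`** (THEOREM-candidate = E-desc-156 (e = 2) + the Brandt spectral
formula in the `θ₄²`-module; desc g22, MEMO-desc §47.13; nothing asserted).  For an elliptic curve of conductor `9p` (`p ≥ 5`
prime) whose newform has a unit-invariant `θ₄²`-Hecke eigenvector `g` (Kodaira `Iₙ*` at 3) with `3 ∤ cont(Wg)` and `Wg` not
Eisenstein mod 3: SOME element of `Ω₃(9p)` has `f_E`-coordinate `q` with `ord₃ q ≤ 1 − v₃(6⟨g,g⟩)`.  Census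
(HOME/desc/g22/nb/E157sq-check.txt): hypotheses met on 24 of the 25 `Iₙ*` classes `9p ≤ 441` (not on 153b1), theta depth
`= v₃⟨g,g⟩` on 24/24; spectral formula 4606/4606 (both characters); on the 21 of them with `3 ∤ n` the theta depth equals the
Néron line depth `ord₃ r_Ω` (21/21 — the content of E-desc-159d), on the 3 with `3 ∣ n` (99b1, 387d1, 423b1) it is one less.
Why it might fail: failure of E-desc-156 for `e = 2`, or an `Iₙ*` class where the cuspidal theta span misses the predicted
`f_E`-depth although `Wg ≢ const (mod 3)` (none in range). [cite: CremonaEcdata] [cite: Gross1987Heights, §3 (Brandt module, heights; dictionary)] -/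
@[conjecture]
def ThetaFourSqOmegaWitnessAtNinePrime : Prop :=
  ∀ (p : ℕ), p.Prime → 5 ≤ p →
  ∀ (W : WeierstrassCurve ℚ) [W.IsElliptic] [NeZero (W.conductorNorm ℤ)]
    (D : ModularParametrizationData W (W.conductorNorm ℤ)),
    W.conductorNorm ℤ = 9 * p →
  ∀ g : Fin (p + 1) → ZI,
    IsUnitInvariant3 p g → IsThetaFourSqHeckeEigen p g (fun n => W.LFunction n) →
    WeightedNotThreeDivisible p g → WeightedDifferenceNotThreeDivisible p g →
    ∃ x ∈ omegaLatticeAtThree (W.conductorNorm ℤ), ∃ q : ℚ, q ≠ 0 ∧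
      (q : ℂ) * peterssonProduct (Gamma0 (W.conductorNorm ℤ)) 2 D.f D.f =
        peterssonProduct (Gamma0 (W.conductorNorm ℤ)) 2 D.f x ∧
      padicValRat 3 q + padicValInt 3 (thetaFourHeightSix p g) ≤ 1

section Glue

/-- Pure arithmetic: the `3`-adic content of an identity of the shape of E-desc-124 (`3 m² deg φ = 4 n · (6⟨g,g⟩)`) when
`3 ∤ n`: `v₃(6⟨g,g⟩) = v₃ deg φ + 1 + 2 v₃ m ≥ v₃ deg φ + 1`. -/
theorem height_val_of_sqDegreeLaw {d m : ℕ} (hd : 0 < d) (hm : 1 ≤ m) {n H : ℤ} (hn : ¬ (3 : ℤ) ∣ n)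
    (h : 3 * (m : ℤ) ^ 2 * (d : ℤ) = 4 * n * H) : padicValNat 3 d + 1 ≤ padicValInt 3 H := by
  haveI : Fact (Nat.Prime 3) := ⟨Nat.prime_three⟩
  have hn0 : n ≠ 0 := by rintro rfl; exact hn (dvd_zero 3)
  have hH : H ≠ 0 := by
    rintro rfl
    have : (3 * (m : ℤ) ^ 2) * (d : ℤ) = 0 := by simpa using h
    rcases mul_eq_zero.mp this with h0 | h0
    · have : (m : ℤ) = 0 := by
        rcases mul_eq_zero.mp h0 with h3 | hm2
        · norm_num at h3
        · exact pow_eq_zero_iff (n := 2) (by norm_num) |>.mp hm2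
      omega
    · exact hd.ne' (by exact_mod_cast h0)
  have hnat : 3 * m ^ 2 * d = 4 * n.natAbs * H.natAbs := by
    have := congrArg Int.natAbs h
    simpa [Int.natAbs_mul, Int.natAbs_pow] using this
  have hHn : H.natAbs ≠ 0 := Int.natAbs_ne_zero.mpr hH
  have hnn : n.natAbs ≠ 0 := Int.natAbs_ne_zero.mpr hn0
  have hm0 : m ≠ 0 := by omega
  have h34 : padicValNat 3 4 = 0 := padicValNat.eq_zero_of_not_dvd (by norm_num)
  have h33 : padicValNat 3 3 = 1 := padicValNat_self
  have hvn : padicValNat 3 n.natAbs = 0 :=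
    padicValNat.eq_zero_of_not_dvd fun hd3 => hn (Int.natAbs_dvd_natAbs.mp (by simpa using hd3))
  have hv := congrArg (padicValNat 3) hnat
  rw [padicValNat.mul (by positivity) hd.ne', padicValNat.mul (by norm_num) (by positivity), h33,
    padicValNat.mul (by positivity) hHn, padicValNat.mul (by norm_num) hnn, h34, hvn] at hv
  simp only [padicValInt]
  omega

variable {p : ℕ} {W : WeierstrassCurve ℚ} [W.IsElliptic] [W.IsGloballyMinimal] [NeZero (W.conductorNorm ℤ)]
  {D : ModularParametrizationData W (W.conductorNorm ℤ)}

/-- **E-desc-159d (PROVED assembly on Kodaira type `Iₙ*`, `3 ∤ n`, at prime level).**  E-desc-157₂ (theta witness in the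
`θ₄²`-module) ∧ E-desc-124 (desc's `Iₙ*` degree law, tree row, literal) ∧ imc's GIVEN row ⟹ for every `X₀(9p)`-optimal curve
of type `Iₙ*` at 3 with `3 ∤ n = −v₃(j)` carrying a primitive unit-invariant `θ₄²`-eigenvector with `3 ∤ cont(Wg)` and `Wg` not
Eisenstein mod 3: `3 ∤ c_E` and Néron congruence depth at 3. -/
theorem manin_at_three_of_thetaSqWitness_of_degreeLaw (hΘ : ThetaFourSqOmegaWitnessAtNinePrime)
    (hdeg : ThetaFourSqBrandtDegreeLawAtNinePrime) (hp : p.Prime) (h5 : 5 ≤ p) (Δ : NeronFLineDatum W D)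
    (hN : W.conductorNorm ℤ = 9 * p) (hΩ : IsOmegaNeronAtThree Δ)
    (hopt : ∀ z ∈ D.L.lattice, ∃ w ∈ periodLattice D.f, z = D.c * w)
    (hmin : ∀ (W' : WeierstrassCurve ℚ) [W'.IsElliptic] (D' : ModularParametrizationData W' (W.conductorNorm ℤ)),
        D'.f = D.f → D.modularDegree ≤ D'.modularDegree)
    (hj : padicValRat 3 W.j < 0) (hn3 : ¬ (3 : ℤ) ∣ padicValRat 3 W.j)
    {g : Fin (p + 1) → ZI} (hU : IsUnitInvariant3 p g) (hprim : IsPrimitive3 p g)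
    (hH : IsThetaFourSqHeckeEigen p g (fun n => W.LFunction n)) (hW : WeightedNotThreeDivisible p g)
    (hWd : WeightedDifferenceNotThreeDivisible p g) :
    ¬ (3 : ℤ) ∣ D.maninConstant ∧ Δ.NeronCongruenceDepthAt 3 := by
  obtain ⟨m, hm1, _hm5, hlaw⟩ := hdeg p hp h5 W D hN hopt hmin hj g hU hprim hH
  have hn3' : ¬ (3 : ℤ) ∣ -padicValRat 3 W.j := fun h => hn3 ((dvd_neg).mp h)
  have hv := height_val_of_sqDegreeLaw (d := D.modularDegree) D.deg_pos hm1 hn3' hlaw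
  have hv' : (padicValNat 3 D.modularDegree : ℤ) + 1 ≤ (padicValInt 3 (thetaFourHeightSix p g) : ℤ) := by
    exact_mod_cast hv
  obtain ⟨x, hx, q, hq0, hq, hval⟩ := hΘ p hp h5 W D hN g hU hH hW hWd
  exact manin_and_depth_of_omegaWitness Δ hΩ hx hq0 hq (by omega)

end Glue

end Summit.BirchSwinnertonDyer.Rank1Residual.ManinAdditive.ThetaFourOmega
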